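import Literature.Geometry.Kaehler.ComplexTorusAbelianThreefoldStablyNondegenerate
import HarnessLib

/-!
# Moonen–Zarhin 1999 Prop. (3.8) read as «no embedding of `k = End⁰(E)` into the centre of `End⁰(X)` ⟹
# `Hg(X × E) = Hg(X) × Hg(E)`» for a SIMPLE `X`, and Thm. (0.1) (4) for the fourfolds `T × E` — `T` a SIMPLE
# threefold outside case (a), or any threefold with `E` without complex multiplication ((5.4)–(5.5))

Layer `Literature/Geometry/Kaehler`, namespace `Literature.Geometry.Kaehler.ComplexTorus`; lane `lit-hodgefound`
(Track 2 foundations library), Layer A4 (known cases of `D = B`), prover seat `lit-hodgefound-p17` (generation 51),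
self-proposed row g51-#5 — the first dimension-FOUR consequences of g51-#2 (`ComplexTorusAbelianThreefoldStablyNondegenerate`:
every complex abelian threefold satisfies (D)) along Moonen–Zarhin §5 (5.4)–(5.5): «If `dim(X₂) = 3` then `X₁` is an
elliptic curve and we can apply (3.8), which works since we are not in case (a)» ∕ «If we are not in case (a) then there is
no embedding of `End⁰(X₁)` into the center of `End⁰(X₂)`. It thus follows from Proposition (3.8) that
`Hg(X) = Hg(X₁) × Hg(X₂^r)`».  THEOREMS ONLY (no definition, no instance, no notation, no named fact; D-0026, net debt 0).

Case (a) itself (`X ∼ X₁ × X₂`, `X₁` an elliptic curve with complex multiplication by `k`, `X₂` a simple threefold with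
`k ↪ End⁰(X₂)`: Weil classes, `Hg(X) ⊊ Sp_D(V,φ)`) and a NON-simple threefold against a CM elliptic curve are not treated
here.

## Sources, VERBATIM (held `paper:arxiv-math_9901113`)

* B. J. J. Moonen, Yu. G. Zarhin [MoonenZarhin1999LowDim], *Hodge classes on abelian varieties of low dimension*, Math.
  Ann. **315** (1999).  Introduction, case (a) (p0001 L77–L80): «The abelian variety `X` is isogenous to a product
  `X₁ × X₂` where `X₁` is an elliptic curve with complex multiplication by an imaginary quadratic field `k` and where
  `X₂` is a simple abelian threefold such that there exists an embedding `k ↪ End⁰(X₂)`.»; Thm. (0.1) (4)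
  (p0001 L131–L135): «Suppose we are not in one of the cases (a), (b), (c) or (d). Then `Hg(X) = Sp_D(V,φ)` and
  `ℬ•(Xⁿ) = 𝒟•(Xⁿ)` for all `n`.»; §3 Prop. (3.8) (p0007 L55–L61): «Let `X` be an abelian variety and let `E` be an
  elliptic curve, both over `ℂ`. Suppose `Hom(E,X) = 0`. Then either `Hg(X × E) = Hg(X) × Hg(E)` or `End⁰(E) = k` is
  an imaginary quadratic field such that there exists an embedding of `k` into the center of `End⁰(X)`.» and its
  proof (p0007 L65–L74: the centre `C = K₁ × ⋯ × K_m × F₁ × ⋯ × F_n`, «an embedding `k → F_i`»); §5 (5.4)–(5.5)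
  (p0009 L82–L100, quoted above); §3 (3.1), §1 (1.5) (D).
* B. B. Gordon [Gordon1997], *A survey of the Hodge conjecture for abelian varieties* (held `paper:arxiv-alg-geom_9709030`),
  7.6.1–7.6.2, Thm. 7.5.
* H. Lange [Lange2023AbelianVarietiesComplex], *Abelian Varieties over the Complex Numbers* (2023), §7.2.2 Prop. 7.2.5,
  §2.4.4 Cor. 2.4.26 (`Hom(X_ν, X_μ) = 0` for non-isogenous simple factors).

## The argument

The tree's CM half of (3.8) (`ComplexTorusHodgeGroupProductCMEllipticCurveCenterEmbedding`:
`Hg(X × E_τ)(ℂ) ≠ Hg(X)(ℂ) × Hg(E_τ)(ℂ)` for `E_τ` with complex multiplication gives an eigencharacter `χ` of the centre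
of `End⁰(X)` with `τ ∈ χ(centre)`) is read, for SIMPLE `X` (centre = the number FIELD `K = centerField`), through a ring
embedding `φ : K →+* ℂ` with `φ(c) = τ` (the bridge of g51-#1 §2); «no embedding of `k = ℚ(τ)` into `K`» is the
hypothesis `∀ φ c, φ c ≠ τ`, automatic when `K` is totally real.  The non-CM half for simple `X` of dimension `≠ 1`
(`Hom(E_τ, X) = 0`) is the tree's `IsSimple.hodgeGroupC_prod_ellipticPeriod_eq_blockDiagProd_of_card_ne`.  With the
Hodge group split, (3.1) (`forall_divisorClasses_powPeriod_prod_eq_hodgeClasses_of_hodgeGroupC_prod_eq`) transfers (D)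
from `X` and `E_τ` (Tate) to `X × E_τ`; for a threefold `X = T`, (D) is g51-#2.  `T × E_τ` with `E_τ` WITHOUT complex
multiplication and `T` ANY threefold is the tree's hypothesis-free `X × E_τ` theorem
(`ComplexTorusStablyNondegenerateNonCMEllipticFactor` §3) fed with g51-#2.

## Contents

* §1 (simple `X`, any dimension) **`IsSimple.hodgeGroupC_prod_ellipticPeriod_eq_blockDiagProd_of_forall_apply_ne`**
  (`E_τ` with complex multiplication, no `φ : K →+* ℂ` with `φ(c) = τ` ⟹ split), `…_of_card_ne_of_forall_apply_ne`
  (every `E_τ`, `dim X ≠ 1`), **`IsSimple.hodgeGroupC_prod_ellipticPeriod_eq_blockDiagProd_of_isTotallyReal`** (centre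
  totally real, `dim X ≠ 1`: split for EVERY elliptic curve), and the (D)-transfers
  `IsSimple.forall_divisorClasses_powPeriod_prod_ellipticPeriod_eq_hodgeClasses_of_forall_apply_ne` ∕ `…_of_isTotallyReal`.
* §2 (threefolds) **`IsRiemannForm.forall_divisorClasses_powPeriod_prod_ellipticPeriod_eq_hodgeClasses_of_finrank_eq_three_of_ellipticEnd_eq_bot`**
  (`T × E_τ` satisfies (D) for EVERY polarised threefold `T` and every `E_τ` WITHOUT complex multiplication),
  **`IsSimple.forall_divisorClasses_powPeriod_prod_ellipticPeriod_eq_hodgeClasses_of_finrank_eq_three_of_forall_apply_ne`**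
  (`T` simple, not case (a)), **`IsSimple.forall_divisorClasses_powPeriod_prod_ellipticPeriod_eq_hodgeClasses_of_isTotallyReal_of_finrank_eq_three`**
  (`T` simple of type I(1) or I(3): `T × E_τ` satisfies (D) for every `E_τ`), with the Hodge-group splittings
  `IsSimple.hodgeGroupC_prod_ellipticPeriod_eq_blockDiagProd_of_finrank_eq_three_of_forall_apply_ne` ∕ `…_of_isTotallyReal_of_finrank_eq_three`.
-/

noncomputable section

open Module Matrix NumberField

namespace Literature.Geometry.Kaehler

namespace ComplexTorus

/-! ## §1 Simple `X`: no embedding of `k` into the centre field `K` ⟹ `Hg(X × E) = Hg(X) × Hg(E)` -/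

section Simple

variable {κ : Type} [Fintype κ] [DecidableEq κ] [Nonempty κ] {E : Type} [NormedAddCommGroup E] [NormedSpace ℂ E]
  {Ψ : (κ → ℝ) ≃L[ℝ] E} {η : E [⋀^Fin 2]→L[ℝ] ℝ} {τ : ℂ} (hτ : τ.im ≠ 0)

/-- **MOONEN–ZARHIN (3.8) FOR A SIMPLE `X`, CM CURVE: if `E_τ` has complex multiplication (by `k = ℚ(τ)`) and NO ring
embedding `φ : K → ℂ` of the centre `K` of `End⁰(X)` takes the value `τ` («there is no embedding of `End⁰(X₁)` into
the center of `End⁰(X₂)`»), then `Hg(X × E_τ)(ℂ) = Hg(X)(ℂ) × Hg(E_τ)(ℂ)`.**  (`Hom(E, X) = 0` is not needed in this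
half.) [cite: MoonenZarhin1999LowDim, §3 Prop. (3.8) (p0007 L55–L74) and §5 (5.5) (p0009 L97–L100)]
[cite: Lange2023AbelianVarietiesComplex, §7.2.2 Prop. 7.2.5] -/
theorem IsSimple.hodgeGroupC_prod_ellipticPeriod_eq_blockDiagProd_of_forall_apply_ne (hX : IsSimple Ψ)
    (hη : IsRiemannForm Ψ η) (hCM : ellipticEnd hτ ≠ ⊥) (hne : ∀ φ : centerField Ψ hX →+* ℂ, ∀ c, φ c ≠ τ) :
    hodgeGroupC (prodPeriod Ψ (ellipticPeriod hτ)) = blockDiagProd (hodgeGroupC Ψ) (hodgeGroupC (ellipticPeriod hτ)) := by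
  by_contra h
  obtain ⟨-, -, χ, -, hτχ⟩ := hη.exists_eigencharacter_center_endAlgRat_of_hodgeGroupC_prod_ellipticPeriod_ne hτ hCM h
  obtain ⟨c, hc⟩ := (AlgHom.mem_range χ).1 hτχ
  -- `χ` as a ring embedding of the centre FIELD `K` (type synonym of the centre, with its own field structure)
  obtain ⟨φ, hφ⟩ : ∃ φ : centerField Ψ hX →+* ℂ, ∀ x, φ x = χ x := ⟨χ.toRingHom, fun _ ↦ rfl⟩
  exact hne φ c ((hφ c).trans hc)

/-- **(3.8) FOR A SIMPLE `X` OF DIMENSION `≠ 1`, EVERY ELLIPTIC CURVE**: if no ring embedding of the centre `K` of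
`End⁰(X)` takes the value `τ`, then `Hg(X × E_τ)(ℂ) = Hg(X)(ℂ) × Hg(E_τ)(ℂ)` — for `E_τ` without complex multiplication
by Lemma (3.5) (`Hom(E_τ, X) = 0` as `X` is simple of dimension `≠ 1`), for `E_τ` with complex multiplication by the
previous theorem. [cite: MoonenZarhin1999LowDim, §3 Prop. (3.8) (p0007 L55–L74), Lemma (3.5) and §5 (5.4)–(5.5) (p0009 L82–L100)]
[cite: Lange2023AbelianVarietiesComplex, §2.4.4 Cor. 2.4.26] -/
theorem IsSimple.hodgeGroupC_prod_ellipticPeriod_eq_blockDiagProd_of_card_ne_of_forall_apply_ne (hX : IsSimple Ψ)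
    (hη : IsRiemannForm Ψ η) (hcard : Fintype.card κ ≠ 2) (hne : ∀ φ : centerField Ψ hX →+* ℂ, ∀ c, φ c ≠ τ) :
    hodgeGroupC (prodPeriod Ψ (ellipticPeriod hτ)) = blockDiagProd (hodgeGroupC Ψ) (hodgeGroupC (ellipticPeriod hτ)) := by
  by_cases hE : ellipticEnd hτ = ⊥
  · exact hX.hodgeGroupC_prod_ellipticPeriod_eq_blockDiagProd_of_card_ne hτ ⟨η, hη⟩ hE hcard
  · exact hX.hodgeGroupC_prod_ellipticPeriod_eq_blockDiagProd_of_forall_apply_ne hτ hη hE hne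

/-- **A SIMPLE `X` OF DIMENSION `≠ 1` WHOSE ENDOMORPHISM ALGEBRA HAS TOTALLY REAL CENTRE (types I, II, III) SPLITS OFF
EVERY ELLIPTIC CURVE: `Hg(X × E_τ)(ℂ) = Hg(X)(ℂ) × Hg(E_τ)(ℂ)`** — in the proof of (3.8) the centre `C = K₁ × ⋯ × K_m ×
F₁ × ⋯ × F_n` then has no CM factor `F_i` to receive `k` (every complex embedding of `K` is real, `τ ∉ ℝ`).
[cite: MoonenZarhin1999LowDim, §3 Prop. (3.8), proof (p0007 L65–L74)] [cite: Lange2023AbelianVarietiesComplex, §7.2.2 Prop. 7.2.5] -/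
theorem IsSimple.hodgeGroupC_prod_ellipticPeriod_eq_blockDiagProd_of_isTotallyReal (hX : IsSimple Ψ)
    [IsTotallyReal (centerField Ψ hX)] (hη : IsRiemannForm Ψ η) (hcard : Fintype.card κ ≠ 2) :
    hodgeGroupC (prodPeriod Ψ (ellipticPeriod hτ)) = blockDiagProd (hodgeGroupC Ψ) (hodgeGroupC (ellipticPeriod hτ)) := by
  refine hX.hodgeGroupC_prod_ellipticPeriod_eq_blockDiagProd_of_card_ne_of_forall_apply_ne hτ hη hcard fun φ c hc ↦ hτ ?_
  rw [← hc, ← (IsTotallyReal.complexEmbedding_isReal φ).coe_embedding_apply c, Complex.ofReal_im]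

/-- **(D) for `X × E_τ`, `X` simple of dimension `≠ 1`, stably nondegenerate, with no embedding of `ℚ(τ)` into the
centre of `End⁰(X)`**: the Hodge group splits (above), so (3.1) transfers (D) from `X` and `E_τ` (Tate) to `X × E_τ`.
[cite: MoonenZarhin1999LowDim, §3 (3.1) (p0006 L53–L61), Prop. (3.8) and §1 (1.5)] [cite: Gordon1997, 7.6.1–7.6.2] -/
theorem IsSimple.forall_divisorClasses_powPeriod_prod_ellipticPeriod_eq_hodgeClasses_of_forall_apply_ne (hX : IsSimple Ψ)
    (hη : IsRiemannForm Ψ η) (hcard : Fintype.card κ ≠ 2) (hne : ∀ φ : centerField Ψ hX →+* ℂ, ∀ c, φ c ≠ τ)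
    (hSN : ∀ k p, divisorClasses (powPeriod Ψ k) p = hodgeClasses (powPeriod Ψ k) p) :
    ∀ k p, divisorClasses (powPeriod (prodPeriod Ψ (ellipticPeriod hτ)) k) p =
      hodgeClasses (powPeriod (prodPeriod Ψ (ellipticPeriod hτ)) k) p :=
  forall_divisorClasses_powPeriod_prod_eq_hodgeClasses_of_hodgeGroupC_prod_eq
    (hX.hodgeGroupC_prod_ellipticPeriod_eq_blockDiagProd_of_card_ne_of_forall_apply_ne hτ hη hcard hne) hSN
    (fun k p ↦ divisorClasses_eq_hodgeClasses_ellipticPow hτ k p)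

/-- **(D) for `X × E_τ`, `X` simple of dimension `≠ 1` with totally real centre and stably nondegenerate, `E_τ` ANY
elliptic curve.** [cite: MoonenZarhin1999LowDim, §3 (3.1), Thm. (3.2) (1)–(2) and Prop. (3.8)] [cite: Gordon1997, Thm. 7.6.2] -/
theorem IsSimple.forall_divisorClasses_powPeriod_prod_ellipticPeriod_eq_hodgeClasses_of_isTotallyReal (hX : IsSimple Ψ)
    [IsTotallyReal (centerField Ψ hX)] (hη : IsRiemannForm Ψ η) (hcard : Fintype.card κ ≠ 2)
    (hSN : ∀ k p, divisorClasses (powPeriod Ψ k) p = hodgeClasses (powPeriod Ψ k) p) :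
    ∀ k p, divisorClasses (powPeriod (prodPeriod Ψ (ellipticPeriod hτ)) k) p =
      hodgeClasses (powPeriod (prodPeriod Ψ (ellipticPeriod hτ)) k) p :=
  forall_divisorClasses_powPeriod_prod_eq_hodgeClasses_of_hodgeGroupC_prod_eq
    (hX.hodgeGroupC_prod_ellipticPeriod_eq_blockDiagProd_of_isTotallyReal hτ hη hcard) hSN
    (fun k p ↦ divisorClasses_eq_hodgeClasses_ellipticPow hτ k p)

end Simple

/-! ## §2 The fourfolds `T × E`: `T` a threefold, `E` an elliptic curve, outside case (a) -/

section Threefold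

variable {κ : Type} [Fintype κ] [DecidableEq κ] {E : Type} [NormedAddCommGroup E] [NormedSpace ℂ E]
  [FiniteDimensional ℂ E] {Ψ : (κ → ℝ) ≃L[ℝ] E} {η : E [⋀^Fin 2]→L[ℝ] ℝ} {τ : ℂ} (hτ : τ.im ≠ 0)

/-- **`T × E_τ` SATISFIES CONDITION (D) FOR EVERY POLARISED ABELIAN THREEFOLD `T` AND EVERY ELLIPTIC CURVE `E_τ`
WITHOUT COMPLEX MULTIPLICATION** (then case (a) cannot occur): `T` satisfies (D) (g51-#2) and the tree's
hypothesis-free «`X` stably nondegenerate, `End(E_τ) = ℤ` ⟹ `X × E_τ` stably nondegenerate» ((3.8) + (3.1) + Hazama's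
remarks). [cite: MoonenZarhin1999LowDim, Thm. (0.1) (4) (p0001 L131–L135), §3 Prop. (3.8) and §5 (5.2), (5.4) (p0008 L107–L111, p0009 L82–L93)]
[cite: Gordon1997, Thm. 7.5 and 7.6.1–7.6.2] -/
theorem IsRiemannForm.forall_divisorClasses_powPeriod_prod_ellipticPeriod_eq_hodgeClasses_of_finrank_eq_three_of_ellipticEnd_eq_bot
    (hη : IsRiemannForm Ψ η) (h3 : finrank ℂ E = 3) (hE : ellipticEnd hτ = ⊥) :
    ∀ k p, divisorClasses (powPeriod (prodPeriod Ψ (ellipticPeriod hτ)) k) p =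
      hodgeClasses (powPeriod (prodPeriod Ψ (ellipticPeriod hτ)) k) p :=
  hη.forall_divisorClasses_powPeriod_prod_ellipticPeriod_eq_hodgeClasses_of_ellipticEnd_eq_bot hτ hE
    (hη.forall_divisorClasses_powPeriod_eq_hodgeClasses_of_finrank_eq_three h3)

/-- The `IsAbelianVariety` form: `T × E_τ` satisfies (D) for every complex abelian threefold `T` and every `E_τ` without
complex multiplication. [cite: MoonenZarhin1999LowDim, Thm. (0.1) (4) and §5 (5.2), (5.4)] [cite: Gordon1997, 7.6.2] -/
theorem IsAbelianVariety.forall_divisorClasses_powPeriod_prod_ellipticPeriod_eq_hodgeClasses_of_finrank_eq_three_of_ellipticEnd_eq_bot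
    (hA : IsAbelianVariety Ψ) (h3 : finrank ℂ E = 3) (hE : ellipticEnd hτ = ⊥) :
    ∀ k p, divisorClasses (powPeriod (prodPeriod Ψ (ellipticPeriod hτ)) k) p =
      hodgeClasses (powPeriod (prodPeriod Ψ (ellipticPeriod hτ)) k) p := by
  obtain ⟨η, hη⟩ := hA
  exact hη.forall_divisorClasses_powPeriod_prod_ellipticPeriod_eq_hodgeClasses_of_finrank_eq_three_of_ellipticEnd_eq_bot hτ
    h3 hE

end Threefold

section SimpleThreefold

variable {κ : Type} [Fintype κ] [DecidableEq κ] [Nonempty κ] {E : Type} [NormedAddCommGroup E] [NormedSpace ℂ E]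
  [FiniteDimensional ℂ E] {Ψ : (κ → ℝ) ≃L[ℝ] E} {η : E [⋀^Fin 2]→L[ℝ] ℝ} {τ : ℂ} (hτ : τ.im ≠ 0)

/-- **SIMPLE THREEFOLD `T`, NOT CASE (a): `Hg(T × E_τ)(ℂ) = Hg(T)(ℂ) × Hg(E_τ)(ℂ)`** whenever no ring embedding of the
centre `F` of `End⁰(T)` (`= End⁰(T)`) takes the value `τ` — «we can apply (3.8), which works since we are not in case (a)».
[cite: MoonenZarhin1999LowDim, §5 (5.4)–(5.5) (p0009 L82–L100) and §3 Prop. (3.8)] -/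
theorem IsSimple.hodgeGroupC_prod_ellipticPeriod_eq_blockDiagProd_of_finrank_eq_three_of_forall_apply_ne (hX : IsSimple Ψ)
    (hη : IsRiemannForm Ψ η) (h3 : finrank ℂ E = 3) (hne : ∀ φ : centerField Ψ hX →+* ℂ, ∀ c, φ c ≠ τ) :
    hodgeGroupC (prodPeriod Ψ (ellipticPeriod hτ)) = blockDiagProd (hodgeGroupC Ψ) (hodgeGroupC (ellipticPeriod hτ)) :=
  hX.hodgeGroupC_prod_ellipticPeriod_eq_blockDiagProd_of_card_ne_of_forall_apply_ne hτ hη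
    (by rw [card_eq_two_mul_finrank Ψ, h3]; norm_num) hne

/-- **MOONEN–ZARHIN THM. (0.1) (4) FOR `X = T × E_τ`, `T` A SIMPLE THREEFOLD, OUTSIDE CASE (a): `ℬ•(Xⁿ) = 𝒟•(Xⁿ)` for
all `n`** — if `k = ℚ(τ)` (when `E_τ` has complex multiplication) does not embed into `F = End⁰(T)` (no `φ : F → ℂ`
with `φ(c) = τ`), then `T × E_τ` satisfies (D): the Hodge group splits and `T` satisfies (D) (g50-#7 ∕ g51-#2).
[cite: MoonenZarhin1999LowDim, Thm. (0.1) (4) with case (a) (p0001 L77–L80, L131–L135), §5 (5.4)–(5.5) (p0009 L82–L100), §3 (3.1), Prop. (3.8)]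
[cite: Gordon1997, Thm. 7.5 and 7.6.2] -/
theorem IsSimple.forall_divisorClasses_powPeriod_prod_ellipticPeriod_eq_hodgeClasses_of_finrank_eq_three_of_forall_apply_ne
    (hX : IsSimple Ψ) (hη : IsRiemannForm Ψ η) (h3 : finrank ℂ E = 3)
    (hne : ∀ φ : centerField Ψ hX →+* ℂ, ∀ c, φ c ≠ τ) :
    ∀ k p, divisorClasses (powPeriod (prodPeriod Ψ (ellipticPeriod hτ)) k) p =
      hodgeClasses (powPeriod (prodPeriod Ψ (ellipticPeriod hτ)) k) p :=
  forall_divisorClasses_powPeriod_prod_eq_hodgeClasses_of_hodgeGroupC_prod_eq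
    (hX.hodgeGroupC_prod_ellipticPeriod_eq_blockDiagProd_of_finrank_eq_three_of_forall_apply_ne hτ hη h3 hne)
    (hη.forall_divisorClasses_powPeriod_eq_hodgeClasses_of_finrank_eq_three h3)
    (fun k p ↦ divisorClasses_eq_hodgeClasses_ellipticPow hτ k p)

/-- **SIMPLE THREEFOLDS OF TYPE I(1) OR I(3) (centre totally real: `End⁰(T) = ℚ` or a totally real cubic field) SPLIT
OFF EVERY ELLIPTIC CURVE: `Hg(T × E_τ)(ℂ) = Hg(T)(ℂ) × Hg(E_τ)(ℂ)`** — case (a) needs a CM field `F ⊇ k`.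
[cite: MoonenZarhin1999LowDim, §2 (2.3) Types I(1), I(3), §3 Prop. (3.8) (proof, p0007 L65–L74) and §5 (5.4)] -/
theorem IsSimple.hodgeGroupC_prod_ellipticPeriod_eq_blockDiagProd_of_isTotallyReal_of_finrank_eq_three (hX : IsSimple Ψ)
    [IsTotallyReal (centerField Ψ hX)] (hη : IsRiemannForm Ψ η) (h3 : finrank ℂ E = 3) :
    hodgeGroupC (prodPeriod Ψ (ellipticPeriod hτ)) = blockDiagProd (hodgeGroupC Ψ) (hodgeGroupC (ellipticPeriod hτ)) :=
  hX.hodgeGroupC_prod_ellipticPeriod_eq_blockDiagProd_of_isTotallyReal hτ hη (by rw [card_eq_two_mul_finrank Ψ, h3]; norm_num)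

/-- **`T × E_τ` SATISFIES CONDITION (D) FOR EVERY SIMPLE THREEFOLD `T` OF TYPE I(1) OR I(3) AND EVERY ELLIPTIC CURVE
`E_τ`** (with or without complex multiplication). [cite: MoonenZarhin1999LowDim, Thm. (0.1) (4) (p0001 L131–L135), §2 (2.3), §3 (3.1), Prop. (3.8) and §5 (5.4)]
[cite: Gordon1997, Thm. 7.6.2] -/
theorem IsSimple.forall_divisorClasses_powPeriod_prod_ellipticPeriod_eq_hodgeClasses_of_isTotallyReal_of_finrank_eq_three
    (hX : IsSimple Ψ) [IsTotallyReal (centerField Ψ hX)] (hη : IsRiemannForm Ψ η) (h3 : finrank ℂ E = 3) :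
    ∀ k p, divisorClasses (powPeriod (prodPeriod Ψ (ellipticPeriod hτ)) k) p =
      hodgeClasses (powPeriod (prodPeriod Ψ (ellipticPeriod hτ)) k) p :=
  forall_divisorClasses_powPeriod_prod_eq_hodgeClasses_of_hodgeGroupC_prod_eq
    (hX.hodgeGroupC_prod_ellipticPeriod_eq_blockDiagProd_of_isTotallyReal_of_finrank_eq_three hτ hη h3)
    (hη.forall_divisorClasses_powPeriod_eq_hodgeClasses_of_finrank_eq_three h3)
    (fun k p ↦ divisorClasses_eq_hodgeClasses_ellipticPow hτ k p)

end SimpleThreefold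

end ComplexTorus

end Literature.Geometry.Kaehler
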